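import Summits.BirchSwinnertonDyer.BirchSwinnertonDyer.Theorems.OneSidedTwistSqueezeX9KatoDivisibilityX9ReciprocityPkLocal
import Summits.BirchSwinnertonDyer.BirchSwinnertonDyer.Theorems.OneSidedTwistSqueezeX9KatoDivisibilityX9KolyvaginReciprocityPkOfLocal
import Summits.BirchSwinnertonDyer.BirchSwinnertonDyer.Theorems.OneSidedTwistSqueezeX9KatoDivisibilityX9StubReciprocityPkAX9Assembly
import HarnessLib

set_option autoImplicit false

-- the summit and its single problem are both named `BirchSwinnertonDyer` (registry layout D-0017)
set_option linter.dupNamespace false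

/-!
# Crux `KatoDivisibilityX9` (stmt-BirchSwinnertonDyer-20547), line `graded_euler_loss`: the registered stub
# `stub_reciprocityPkAX9` (1c′, hG34ᵍ — Kolyvagin class and reciprocity over `A = Λ/(p^{d+1}, ω²)`) PROVED

Seat `bsd-line-k6-p4` (prover-bsd-line-k6-p4-g6-0, 6th LEAD).  THEOREM ONLY; `--supports stmt-BirchSwinnertonDyer-20547`
(stub credit: the statement is VERBATIM the registered stub of skeleton v4.1 022afbf84977, = hypothesis `hG34` of the landed
bounded-defect assembly `…GradedCoreAssemblyDefect.fineCoreGraded_of_supply_of_testCocycle_of_kolyvaginPrime_of_reciprocity`).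
Composition of three landed pieces: `localPk` (this lineage, file F: the level-`p^k` local vanishing theorem = Poitou–Tate +
MU-TRANSFER-PROOF Lemma 1 (iii) at level `p^k`, files A–E) ⟹ `kolyvaginReciprocityPk_of_localPk` (g5 worker B, `hKolyRecPk`:
the genuine Euler system's level-`p^{d+1}` Kolyvagin package) ⟹ `stub_reciprocityPkAX9_of_kolyvaginReciprocityPk` (g5, p631775).
HONEST LABEL: closes the DEPTH stub 1c′ only; the crux stays open on WIDTH (`stub_widthX9`) and the cite-only print input F1ζ;
BSD is not advanced by this file.

References: B. Mazur, K. Rubin, Mem. AMS 799 (2004) Prop. 1.3.2, §4.4, §5.3 [MazurRubin2004]; K. Kato, Astérisque 295 (2004)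
§13.3 and Thm. 13.4 [Kato2004Asterisque]; J. S. Milne, ADT I Thm. 4.10 [MilneADT2006].
-/

noncomputable section

open scoped NumberField ContRepresentation
open WeierstrassCurve Field IsDedekindDomain Literature.NumberTheory.GaloisRepresentations
  Literature.NumberTheory.GaloisCohomology
  Literature.NumberTheory.EllipticCurves Literature.NumberTheory.EllipticCurves.Kato2004
  Literature.NumberTheory.EllipticCurves.Kato2004.EulerSystemValues
  Summit.BirchSwinnertonDyer.BirchSwinnertonDyer.Rank1Residual
open Summit.BirchSwinnertonDyer.BirchSwinnertonDyer.Theorems.OneSidedTwistSqueezeX9KatoDivisibilityX9ReciprocityPkLocal (localPk)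
open Summit.BirchSwinnertonDyer.BirchSwinnertonDyer.Theorems.OneSidedTwistSqueezeX9KatoDivisibilityX9KolyvaginReciprocityPkOfLocal
  (kolyvaginReciprocityPk_of_localPk)
open Summit.BirchSwinnertonDyer.BirchSwinnertonDyer.Theorems.OneSidedTwistSqueezeX9KatoDivisibilityX9StubReciprocityPkAX9Assembly
  (stub_reciprocityPkAX9_of_kolyvaginReciprocityPk)

namespace Summit.BirchSwinnertonDyer.BirchSwinnertonDyer.Theorems.OneSidedTwistSqueezeX9KatoDivisibilityX9StubReciprocityPkAX9

/-- **STUB 1c′ `stub_reciprocityPkAX9` (hG34ᵍ over `A = Λ/(p^{d+1}, ω²)`) — PROVED**: the registered signature verbatim, from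
`localPk` ⟹ `hKolyRecPk` ⟹ the stub. [cite: Kato2004Asterisque, §13.3 and Thm. 13.4 (p. 226)]
[cite: MazurRubin2004, Prop. 1.3.2, §4.4, §5.3] -/
theorem stub_reciprocityPkAX9 : ∀ (W : WeierstrassCurve ℚ) [W.IsElliptic] [W.IsGloballyMinimal] (p : ℕ) [Fact p.Prime]
      [ContinuousSMul ℤ_[p] (W.tateModule p)] [Module.Free ℤ_[p] (W.tateModule p)]
      [Module.Finite ℤ_[p] (W.tateModule p)]
      (κ : ZpExtension ℚ p) (γ : absoluteGaloisGroup ℚ) (I : IwasawaH1Data W p κ γ),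
      p ≠ 2 → W.HasIrreducibleModPGaloisRep p → ¬ W.HasSurjectiveModNGaloisRep p →
      κ.IsCyclotomic → κ.IsTopGenerator γ →
      poitouTate_sum_localTatePairing_eq_zero ℚ →
      ∀ (s : I.H), IsEulerSystemClass W p κ γ I s →
      ∀ (d : ℕ) (s' : I.H), s = ((PowerSeries.C (p : ℤ_[p]) : IwasawaAlgebra p) ^ d) • s' →
      ∃ (S₀ : Set (HeightOneSpectrum (𝓞 ℚ))), S₀.Finite ∧
        ∀ (a : ℕ) (κ' : κ.twistTower (W.torsionGaloisModule (p : ℤ))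
            (fun P : geomTorsion W (p : ℤ) => AddSubgroup.torsionBy.nsmul P)),
          (κ.towerShift (W.torsionGaloisModule (p : ℤ))
              (fun P : geomTorsion W (p : ℤ) => AddSubgroup.torsionBy.nsmul P))^[a] κ' = I.redTower s' →
          ∀ (N e' : ℕ), e' + 1 = p ^ N → d ≤ N →
          ∀ (Φ : contOneCocycles (W.modPTwist p κ (2 * e' + 1 + 1)).toTopRep),
            oneCocycleClass (W.modPTwist p κ (2 * e' + 1 + 1)).toTopRep Φ = κ'.1 (2 * e' + 1 + 1) →
          ∀ (J : ℕ), J + 1 = (2 * e' + 1 + 1) * (d + 1) → ∀ (hJe : 2 * e' + 1 + 1 ≤ J + 1),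
          ∀ (ε : ℕ) (S₁ : Set (HeightOneSpectrum (𝓞 ℚ)))
            (ι : (W.torsionGaloisModule (p : ℤ)).toContRepresentation →ⁱL
              (W.torsionGaloisModule ((p : ℤ) ^ (d + 1))).toContRepresentation),
            (∀ P : geomTorsion W (p : ℤ),
              ((ι P : geomTorsion W ((p : ℤ) ^ (d + 1))) : geomPoints W) = (P : geomPoints W)) →
          ∀ (Ψ : galoisCohomology (W.modPkTwist p (d + 1) κ.invTwist (J + 1)) 1)
            (ψb : galoisCohomology (W.modPTwist p κ.invTwist (J + 1)) 1)
            (Ψc : contOneCocycles (W.modPTwist p κ.invTwist (2 * e' + 1 + 1)).toTopRep),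
            S₀ ⊆ S₁ →
            oneCocycleClass (W.modPTwist p κ.invTwist (2 * e' + 1 + 1)).toTopRep Ψc =
              κ.invTwist.truncH1 (W.torsionGaloisModule (p : ℤ))
                (fun P : geomTorsion W (p : ℤ) => AddSubgroup.torsionBy.nsmul P) hJe ψb →
            p ^ d • Ψ = galoisCohomology.map
              (κ.invTwist.twistModPToModPk (W.torsionGaloisModule (p : ℤ)) (J + 1)
                (W.torsionGaloisModule ((p : ℤ) ^ (d + 1)))
                (fun P : geomTorsion W (p : ℤ) => AddSubgroup.torsionBy.nsmul P)
                (W.pow_nsmul_geomTorsion_eq_zero p (d + 1)) ι) 1 ψb →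
            (∀ v : HeightOneSpectrum (𝓞 ℚ), v ∉ S₁ →
              galoisCohomology.localization (W.modPkTwist p (d + 1) κ.invTwist (J + 1)) (Sum.inr v) 1 Ψ ∈
                DiscreteGaloisModule.unramifiedSubgroup
                  (GaloisRep.toLocal v (W.modPkTwist p (d + 1) κ.invTwist (J + 1))) 1) →
            (∀ v : HeightOneSpectrum (𝓞 ℚ), v ∈ S₁ →
              galoisCohomology.localization (W.modPkTwist p (d + 1) κ.invTwist (J + 1)) (Sum.inr v) 1
                (galoisCohomology.map
                  (κ.invTwist.twistModPkShiftEmbed (W.torsionGaloisModule ((p : ℤ) ^ (d + 1)))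
                    (W.pow_nsmul_geomTorsion_eq_zero p (d + 1)) (J + 1) (Nat.sub_le (J + 1) ε)) 1
                  (galoisCohomology.map
                    (κ.invTwist.twistModPkTruncate (W.torsionGaloisModule ((p : ℤ) ^ (d + 1)))
                      (W.pow_nsmul_geomTorsion_eq_zero p (d + 1)) (J + 1) (Nat.sub_le (J + 1) ε)) 1 Ψ)) = 0) →
          ∀ (eW : geomTorsion W (p : ℤ) → geomTorsion W (p : ℤ) → AlgebraicClosure ℚ)
            (hμ : ∀ S T, eW S T ^ p = 1)
            (hadd₁ : ∀ S₁' S₂' T, eW (S₁' + S₂') T = eW S₁' T * eW S₂' T)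
            (hadd₂ : ∀ S T₁ T₂, eW S (T₁ + T₂) = eW S T₁ * eW S T₂),
            (∀ T, eW T T = 1) → (∀ T, (∀ S, eW S T = 1) → T = 0) →
            (∀ (σ : absoluteGaloisGroup ℚ) (S T : geomTorsion W (p : ℤ)), σ • eW S T = eW (σ • S) (σ • T)) →
          ∀ (q : HeightOneSpectrum (𝓞 ℚ)), q ∉ S₁ →
          ∀ 𝔓 ∈ q.primesAbove, ∀ (Fr : absoluteGaloisGroup ℚ), IsArithFrobAt (𝓞 ℚ) Fr 𝔓 →
            galoisRepTorsion W ((p : ℤ) ^ (d + 1)) Fr = 1 →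
            Fr ∈ κ.layerSubgroup N → Fr ∉ κ.layerSubgroup (N + 1) →
          ∃ U : Polynomial ℤ, ¬ ((p : ℤ) ∣ U.coeff 0) ∧
            ∀ i : ℕ, i + ε < 2 * e' + 1 + 1 →
              convCoeff (weilPairingHom W p eW hμ hadd₁ hadd₂) (2 * e' + 1 + 1) i
                (Polynomial.aeval (shiftEnd (geomTorsion W (p : ℤ)) (2 * e' + 1 + 1)) U
                  ((shiftEnd (geomTorsion W (p : ℤ)) (2 * e' + 1 + 1) ^ (e' + 1 + a)) (Φ.1 Fr)))
                (Ψc.1 Fr) = 0 :=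
  stub_reciprocityPkAX9_of_kolyvaginReciprocityPk (kolyvaginReciprocityPk_of_localPk localPk)

end Summit.BirchSwinnertonDyer.BirchSwinnertonDyer.Theorems.OneSidedTwistSqueezeX9KatoDivisibilityX9StubReciprocityPkAX9

end
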